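import Summits.CriticalPhenomena.PercolationContinuityZ3.Theorems.PercNearOneGluingNoHeavyLowerTailQ44TTConeUniversal

/-!
# Block tables of two-copy fibres: star tables, terminal-pair tables, and the vertex-cover labelling (definitions)

Support file for crux `stmt-CriticalPhenomena-4575` (rows `W = 2·Q44`, `U`, `D_U`, `S3` for all `n`), seat `prim-bnk-1` gen 40; memo
`run/shared/lean/prim/prim-l12/FROM-prim-bnk-1-gen40-FIBRE-BRIDGE.md`.  DEFINITIONS ONLY (plus their table facts), split out so that the
law-level vertex-cover theorems (`…Q44VertexCoverLaw`, `…Q44VertexCoverLawW`) are pure-proof files: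
* `tmask`, `glueCell X` (the cell gluing exactly the terminal set `X`; `pp_glueCell` by `decide`);
* `starTab A F` — the STAR TABLE of a fibre vertex with contracted terminals `A` and free terminals `F`:
  `T(s,t) = #{S ⊆ F : glue(A ∪ S) = s, glue(A ∪ (F ∖ S)) = t}`; `starTab_empty`;
* `pairTab k k'` — the table of a free terminal pair (`E`-operator; a free loop `pairTab k k = starTab ∅ {k}`, `pairTab_self`);
* `intV`, `vcBlk` — the vertex-cover labelling of pairs (internal end point, else own vertex set), `vcBlk_star`, `vcBlk_pair`;
* `starIdx A F : Fin 81` — position of `(A, F)` in the star-operator lists `VCCone.starOpW/U/DU/S3` (code 1 contracted, 2 free, base 3).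
No sorries, no named facts; standard axioms.
-/

namespace Summit.CriticalPhenomena.PercolationContinuityZ3.Theorems

namespace VCCone

open TwoCopyMono FourPointAtoms

variable {n : ℕ}

/-! ## Gluing a set of terminals -/

/-- Bitmask of a set of terminal indices. [this work] -/
def tmask (X : Finset (Fin 4)) : ℕ := ∑ k ∈ X, 2 ^ (k : ℕ)

/-- The cell whose only non-trivial block is the terminal set `X` (`⊥` if `|X| ≤ 1`), by bitmask table. [this work] -/
def glueCell (X : Finset (Fin 4)) : Fin 15 :=
  (![0, 0, 0, 6, 0, 5, 3, 13, 0, 4, 2, 12, 1, 10, 7, 14] : Fin 16 → Fin 15) ⟨tmask X % 16, Nat.mod_lt _ (by decide)⟩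

/-- `glueCell X` glues exactly `X`: `k ~ k'` iff `k = k'` or both lie in `X` (table fact). [this work] -/
theorem pp_glueCell : ∀ X : Finset (Fin 4), ∀ k k' : Fin 4,
    pp (glueCell X) k k' = true ↔ (k = k' ∨ (k ∈ X ∧ k' ∈ X)) := by
  decide

/-- The STAR TABLE of a fibre vertex with contracted terminal set `A` and free terminal set `F`:
`T(s,t) = #{S ⊆ F : glue(A ∪ S) = s, glue(A ∪ (F ∖ S)) = t}`. [this work] -/
def starTab (A F : Finset (Fin 4)) : Table := fun s t =>
  (F.powerset.filter fun S => (glueCell (A ∪ S), glueCell (A ∪ (F \ S))) = (s, t)).card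

/-- The table of a FREE terminal pair `{k, k'}` (`E`-operator; for `k = k'`, a free terminal loop, it is `2·δ_(⊥,⊥)`). [this work] -/
def pairTab (k k' : Fin 4) : Table := fun s t =>
  (if ((0 : Fin 15), glueCell {k, k'}) = (s, t) then 1 else 0) + (if (glueCell {k, k'}, (0 : Fin 15)) = (s, t) then 1 else 0)

/-- A free terminal loop has the star table of a single free terminal (table fact). [this work] -/
theorem pairTab_self : ∀ k : Fin 4, ∀ s t : Fin 15, pairTab k k s t = starTab ∅ {k} s t := by
  decide

/-- A star with no free terminal has the one-entry table `δ_(glue A, glue A)`. [this work] -/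
theorem starTab_empty (A : Finset (Fin 4)) (s t : Fin 15) :
    starTab A ∅ s t = if (glueCell A, glueCell A) = (s, t) then 1 else 0 := by
  unfold starTab
  rw [Finset.powerset_empty, Finset.filter_singleton]
  simp only [Finset.union_empty, Finset.sdiff_empty]
  split_ifs <;> simp

/-! ## The vertex-cover labelling -/

/-- The internal (non-terminal) end points of a pair. [this work] -/
def intV (a b c y : Fin n) (e : Sym2 (Fin n)) : Finset (Fin n) :=
  Finset.univ.filter fun v => v ∈ e ∧ ∀ k : Fin 4, quad a b c y k ≠ v

/-- Block label of a pair (vertex-cover class): its internal end points if it has one, else its own vertex set (a terminal pair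
or loop is a block by itself). [this work] -/
def vcBlk (a b c y : Fin n) (e : Sym2 (Fin n)) : Finset (Fin n) :=
  if intV a b c y e = ∅ then Finset.univ.filter fun v => v ∈ e else intV a b c y e

/-- Label of a pair joining an internal vertex `v` to a terminal: `{v}`. [this work] -/
theorem vcBlk_star (a b c y : Fin n) {v : Fin n} (hv : ∀ k, quad a b c y k ≠ v) (k : Fin 4) :
    vcBlk a b c y s(v, quad a b c y k) = {v} := by
  have hI : intV a b c y s(v, quad a b c y k) = {v} := by
    ext u
    simp only [intV, Finset.mem_filter, Finset.mem_univ, true_and, Finset.mem_singleton, Sym2.mem_iff]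
    constructor
    · rintro ⟨h | h, hu⟩
      · exact h
      · exact absurd h.symm (hu k)
    · intro h; exact ⟨Or.inl h, h ▸ hv⟩
  unfold vcBlk
  rw [hI, if_neg (Finset.singleton_ne_empty v)]

/-- Label of a terminal pair: its vertex set. [this work] -/
theorem vcBlk_pair (a b c y : Fin n) (k k' : Fin 4) :
    vcBlk a b c y s(quad a b c y k, quad a b c y k') = Finset.univ.filter fun v => v ∈ s(quad a b c y k, quad a b c y k') := by
  have hI : intV a b c y s(quad a b c y k, quad a b c y k') = ∅ := by
    refine Finset.eq_empty_of_forall_notMem fun u hu => ?_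
    simp only [intV, Finset.mem_filter, Finset.mem_univ, true_and, Sym2.mem_iff] at hu
    obtain ⟨h | h, hu⟩ := hu
    · exact hu k h.symm
    · exact hu k' h.symm
  unfold vcBlk
  rw [if_pos hI]

/-- Index of the star table with contracted set `A` and free set `F` in the list `starOpW` (code `1` contracted, `2` free,
base 3 over `a,b,c,y`). [this work] -/
def starIdx (A F : Finset (Fin 4)) : Fin 81 :=
  ⟨(∑ k : Fin 4, (if k ∈ A then 1 else if k ∈ F then 2 else 0) * 3 ^ (k : ℕ)) % 81, Nat.mod_lt _ (by decide)⟩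

end VCCone

end Summit.CriticalPhenomena.PercolationContinuityZ3.Theorems
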